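import Mathlib
import Summits.ValiantsHypothesis.ValiantsHypothesis.Theorems.BarrierLeverDefinableEquationsCoefficientFunctionCrux
import Summits.ValiantsHypothesis.ValiantsHypothesis.Theorems.BarrierLeverDefinableEquationsIsobaric

/-!
# Crux `BarrierLever.DefinableEquations` (stmt-8745) / `SingleSizeEquations` (stmt-8749) /
# `DefinableDcEquations` (stmt-8746) — EXPLICIT COEFFICIENT FUNCTIONS, GENERIC FORM: the normal
# form for ANY vanishing condition, on the FULL coefficient variables (val-np-p5 g7)

`…CoefficientFunctionCrux.lean` proved `DefinableEquations ⟺` "equations with `N^c`-explicit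
coefficient function" through the top-component normal form.  The two directions (Valiant's
criterion `CoefficientFunction.exists_witness`, coefficient extraction
`CoefficientExtraction.exists_coeffPoly`) are in fact independent of the test class: here they are
packaged for an ARBITRARY property `V` of the equation polynomial over any finite variable type of
cardinality `≤ N` (`ExplicitCoefficients.explicit_of_boolSum`, `…boolSum_of_explicit`; level `a` ⇒
scale `2a+7` ⇒ level `2(2a+7)+7`), and instantiated on the full coefficient variables
`degLEMonomials n` (`|degLEMonomials n| = N`), straight from the DEFINITIONS of the three decls:

* `definableEquations_iff_explicitCoefficients_full` — crux 8745;
* `singleSizeEquations_iff_explicitCoefficients_full` — item 8749 (pointwise, no dilation needed);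
* `definableDcEquations_iff_explicitCoefficients` — crux 8746 (dc slice `deg ≤ n, dc ≤ m(n)`).

"Explicit coefficient function" (bits `degLEMonomials n × Fin (D+1)` ⊕ `Fin r`, one bits-only
polynomial `Q₀`, `D, r, L(Q₀), deg Q₀ ≤ N^c`): exponents of `E` are `≤ D` and
`coeff_m E = ∑_{w ∈ {0,1}^r} Q₀(oneHot m, w)`.  Reductions/normal forms only; all three decls stay
OPEN; nothing here bears on `VP ≠ VNP`.  No definitions, no named facts.
Refs: Bürgisser 2000, Prop. 2.20 / §2.3; Valiant 1979; Chatterjee–Tengse arXiv:2309.07612 §1.3.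
-/

set_option linter.dupNamespace false

noncomputable section

namespace Summit.ValiantsHypothesis.ValiantsHypothesis.Theorems.BarrierLeverDefinableEquations

open MvPolynomial Literature.Computability.AlgebraicComplexity
open Literature.Barriers.ValiantsHypothesis
open scoped BigOperators

namespace ExplicitCoefficients

open CoefficientCrux

variable {ι : Type*} [Fintype ι] [DecidableEq ι]

/-- **Boolean-sum witness ⇒ explicit coefficient function, for any property `V`** (level `a` at
budget `N ≥ 3`, `|ι| ≤ N` ⇒ scale `2a + 7`): coefficient extraction with `D = N^a`.
[cite: Burgisser2000, Prop. 2.20] -/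
theorem explicit_of_boolSum {N a : ℕ} (hN : 3 ≤ N) (hI : Fintype.card ι ≤ N)
    (V : MvPolynomial ι ℂ → Prop)
    (h : ∃ q : ℕ, q ≤ N ^ a ∧ ∃ H : MvPolynomial (ι ⊕ Fin q) ℂ,
      complexity H ≤ N ^ a ∧ H.totalDegree ≤ N ^ a ∧ boolSum H ≠ 0 ∧ V (boolSum H)) :
    ∃ D r : ℕ, D ≤ N ^ (2 * a + 7) ∧ r ≤ N ^ (2 * a + 7) ∧
      ∃ Q₀ : MvPolynomial ((ι × Fin (D + 1)) ⊕ Fin r) ℂ,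
        complexity Q₀ ≤ N ^ (2 * a + 7) ∧ Q₀.totalDegree ≤ N ^ (2 * a + 7) ∧
        ∃ E : MvPolynomial ι ℂ, E ≠ 0 ∧ V E ∧ (∀ m ∈ E.support, ∀ e, m e ≤ D) ∧
          ∀ m : ι →₀ ℕ, (∀ e, m e ≤ D) → coeff m E =
            ∑ w : Fin r → Bool, eval (fun x => if Sum.elim
              (fun p : ι × Fin (D + 1) => decide (m p.1 = (p.2 : ℕ))) w x
              then (1 : ℂ) else 0) Q₀ := by
  classical
  obtain ⟨q, hq, H, hHc, hHd, hne, hV⟩ := h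
  have hdeg : (boolSum H).totalDegree ≤ N ^ a := by
    refine le_trans ?_ hHd
    unfold boolSum
    refine totalDegree_finsetSum_le fun e _ => ?_
    rw [show aeval (Sum.elim X fun j => if e j then (1 : MvPolynomial ι ℂ) else 0) H =
        bind₁ (Sum.elim X fun j => if e j then (1 : MvPolynomial ι ℂ) else 0) H from rfl]
    refine (FSV2018.totalDegree_bind₁_le_mul _ 1 (fun v => ?_) H).trans (by rw [mul_one])
    rcases v with i | j
    · rw [Sum.elim_inl, totalDegree_X]
    · simp only [Sum.elim_inr]
      split_ifs
      · rw [totalDegree_one]; exact Nat.zero_le _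
      · rw [totalDegree_zero]; exact Nat.zero_le _
  obtain ⟨Q₀, hsum, hQc, hQd⟩ := CoefficientExtraction.exists_coeffPoly (ι := ι) (N ^ a) H hdeg
  obtain ⟨hr, -, hL, hd, -, hD⟩ := arith (x := q) hN hI hq hHc hHd
  refine ⟨N ^ a, q + Fintype.card ι * (N ^ a + 1), hD, hr, Q₀, hQc.trans hL, hQd.trans hd,
    boolSum H, hne, hV, fun m hm => CoefficientExtraction.apply_le_of_mem_support hdeg hm,
    fun m hm => ?_⟩
  rw [← hsum, coeff_expSum, dif_pos hm, bits_eq m hm]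

/-- **Explicit coefficient function ⇒ Boolean-sum witness, for any property `V`** (scale `c` at
budget `N ≥ 3`, `|ι| ≤ N` ⇒ level `2c + 7`): Valiant's criterion.
[cite: Burgisser2000, Prop. 2.20] -/
theorem boolSum_of_explicit {N c : ℕ} (hN : 3 ≤ N) (hI : Fintype.card ι ≤ N)
    (V : MvPolynomial ι ℂ → Prop)
    (h : ∃ D r : ℕ, D ≤ N ^ c ∧ r ≤ N ^ c ∧
      ∃ Q₀ : MvPolynomial ((ι × Fin (D + 1)) ⊕ Fin r) ℂ,
        complexity Q₀ ≤ N ^ c ∧ Q₀.totalDegree ≤ N ^ c ∧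
        ∃ E : MvPolynomial ι ℂ, E ≠ 0 ∧ V E ∧ (∀ m ∈ E.support, ∀ e, m e ≤ D) ∧
          ∀ m : ι →₀ ℕ, (∀ e, m e ≤ D) → coeff m E =
            ∑ w : Fin r → Bool, eval (fun x => if Sum.elim
              (fun p : ι × Fin (D + 1) => decide (m p.1 = (p.2 : ℕ))) w x
              then (1 : ℂ) else 0) Q₀) :
    ∃ q : ℕ, q ≤ N ^ (2 * c + 7) ∧ ∃ H : MvPolynomial (ι ⊕ Fin q) ℂ,
      complexity H ≤ N ^ (2 * c + 7) ∧ H.totalDegree ≤ N ^ (2 * c + 7) ∧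
      boolSum H ≠ 0 ∧ V (boolSum H) := by
  classical
  obtain ⟨D, r, hD, hr, Q₀, hQc, hQd, E, hE0, hV, hsupp, hcoeff⟩ := h
  obtain ⟨H, hsum, hHc, hHd⟩ := CoefficientFunction.exists_witness (ι := ι) D r (rename Sum.inr Q₀)
  have hφ : ∀ (m : ι → Fin (D + 1)) (w : Fin r → Bool),
      aeval (boolPt (Sum.elim (fun p : ι × Fin (D + 1) => decide (m p.1 = p.2)) w))
        (rename Sum.inr Q₀) =
        C (eval (fun x => if Sum.elim (fun p : ι × Fin (D + 1) => decide (m p.1 = p.2)) w x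
          then (1 : ℂ) else 0) Q₀) := fun m w => by
    rw [aeval_rename, ← aeval_C_comp]
    have hfg : (boolPt (σ := ι) (Sum.elim (fun p : ι × Fin (D + 1) => decide (m p.1 = p.2)) w)) ∘
        Sum.inr = fun x => C (if Sum.elim (fun p : ι × Fin (D + 1) => decide (m p.1 = p.2)) w x
          then (1 : ℂ) else 0) := by
      funext x
      by_cases hx : Sum.elim (fun p : ι × Fin (D + 1) => decide (m p.1 = p.2)) w x
      · simp only [Function.comp_apply, boolPt, Sum.elim_inr, hx, if_true, map_one]
      · have hx' : Sum.elim (fun p : ι × Fin (D + 1) => decide (m p.1 = p.2)) w x = false := by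
          simpa using hx
        simp [boolPt, hx']
    rw [hfg]
  have hEsum : boolSum H = E := by
    rw [hsum]
    have hstep : ∀ m : ι → Fin (D + 1),
        (∑ w : Fin r → Bool,
          aeval (boolPt (Sum.elim (fun p : ι × Fin (D + 1) => decide (m p.1 = p.2)) w))
              (rename Sum.inr Q₀) * ∏ e : ι, (X e : MvPolynomial ι ℂ) ^ (m e : ℕ)) =
        C (∑ w : Fin r → Bool, eval (fun x => if Sum.elim
            (fun p : ι × Fin (D + 1) => decide (m p.1 = p.2)) w x then (1 : ℂ) else 0) Q₀) *
          ∏ e : ι, (X e : MvPolynomial ι ℂ) ^ (m e : ℕ) := by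
      intro m
      rw [map_sum, Finset.sum_mul]
      exact Finset.sum_congr rfl fun w _ => by rw [hφ m w]
    rw [Finset.sum_congr rfl fun m _ => hstep m]
    symm
    refine eq_expSum_of_coeff D _ E fun m => ?_
    by_cases hm : ∀ e, m e ≤ D
    · rw [hcoeff m hm, dif_pos hm, bits_eq m hm]
    · rw [dif_neg hm]
      exact notMem_support_iff.mp fun hmem => hm (hsupp m hmem)
  obtain ⟨-, hq, hL, -, hd, -⟩ := arith (z := Q₀.totalDegree) hN hI hr hQc hQd
  refine ⟨Fintype.card ι * (D + 1) + r, le_trans (by gcongr) hq, H, ?_, ?_, ?_, ?_⟩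
  · refine hHc.trans (le_trans ?_ hL)
    have := complexity_rename_le_holds' (Sum.inr : _ → ι ⊕ _) Q₀
    gcongr
  · refine hHd.trans (le_trans ?_ hd)
    have := totalDegree_rename_le (Sum.inr : _ → ι ⊕ _) Q₀
    gcongr
  · rw [hEsum]; exact hE0
  · rw [hEsum]; exact hV

end ExplicitCoefficients

open ExplicitCoefficients
open Summit.ValiantsHypothesis.ValiantsHypothesis.Theorems.BarrierLever.IsobaricEquations
  (card_degLEMonomials)

/-- `3 ≤ C(2n,n)` and `|degLEMonomials n| ≤ C(2n,n)` for `n ≥ 2`. [folklore] -/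
theorem ExplicitCoefficients.budget {n : ℕ} (hn : 2 ≤ n) [Fintype ↥(degLEMonomials n)] :
    3 ≤ Nat.choose (2 * n) n ∧ Fintype.card ↥(degLEMonomials n) ≤ Nat.choose (2 * n) n := by
  have hnN : 2 * n ≤ Nat.choose (2 * n) n := by
    have h1 := Nat.choose_le_middle 1 (2 * n)
    rwa [Nat.choose_one_right, Nat.mul_div_cancel_left n Nat.two_pos] at h1
  exact ⟨by omega, (card_degLEMonomials n).le⟩

/-- **Crux 8745 on the full coefficient variables**: `DefinableEquations` holds iff for some `c`,
for every `b`, eventually in `n`, a NONZERO `E ∈ ℂ[degLEMonomials n]` with `N^c`-explicit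
coefficient function vanishes at `coeff(f)` for every `f ∈ SmallCircuits ℂ n b` (no top-component
reduction: straight from the definition). [cite: Burgisser2000, Prop. 2.20] -/
theorem definableEquations_iff_explicitCoefficients_full :
    Summit.ValiantsHypothesis.ValiantsHypothesis.Theses.BarrierLever.DefinableEquations ↔
    ∃ c : ℕ, ∀ b : ℕ, ∃ n₀ : ℕ, ∀ n ≥ n₀,
      ∃ D r : ℕ, D ≤ (Nat.choose (2 * n) n) ^ c ∧ r ≤ (Nat.choose (2 * n) n) ^ c ∧
      ∃ Q₀ : MvPolynomial ((↥(degLEMonomials n) × Fin (D + 1)) ⊕ Fin r) ℂ,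
        complexity Q₀ ≤ (Nat.choose (2 * n) n) ^ c ∧
        Q₀.totalDegree ≤ (Nat.choose (2 * n) n) ^ c ∧
        ∃ E : MvPolynomial ↥(degLEMonomials n) ℂ, E ≠ 0 ∧
          (∀ f ∈ SmallCircuits ℂ n b, eval (coeffVector (degLEMonomials n) f) E = 0) ∧
          (∀ m ∈ E.support, ∀ e, m e ≤ D) ∧
          ∀ m : ↥(degLEMonomials n) →₀ ℕ, (∀ e, m e ≤ D) → coeff m E =
            ∑ w : Fin r → Bool, eval (fun x => if Sum.elim
              (fun p : ↥(degLEMonomials n) × Fin (D + 1) => decide (m p.1 = (p.2 : ℕ))) w x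
              then (1 : ℂ) else 0) Q₀ := by
  classical
  constructor
  · rintro ⟨a, ha⟩
    refine ⟨2 * a + 7, fun b => ?_⟩
    obtain ⟨n₀, hn₀⟩ := ha b
    refine ⟨max n₀ 2, fun n hn => ?_⟩
    haveI : Fintype ↥(degLEMonomials n) := (Finsupp.finite_of_degree_le (σ := Fin n) n).fintype
    obtain ⟨hN, hI⟩ := ExplicitCoefficients.budget (le_trans (le_max_right _ _) hn)
    exact explicit_of_boolSum hN hI
      (fun E => ∀ f ∈ SmallCircuits ℂ n b, eval (coeffVector (degLEMonomials n) f) E = 0)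
      (hn₀ n (le_trans (le_max_left _ _) hn))
  · rintro ⟨c, hc⟩
    refine ⟨2 * c + 7, fun b => ?_⟩
    obtain ⟨n₀, hn₀⟩ := hc b
    refine ⟨max n₀ 2, fun n hn => ?_⟩
    haveI : Fintype ↥(degLEMonomials n) := (Finsupp.finite_of_degree_le (σ := Fin n) n).fintype
    obtain ⟨hN, hI⟩ := ExplicitCoefficients.budget (le_trans (le_max_right _ _) hn)
    exact boolSum_of_explicit hN hI
      (fun E => ∀ f ∈ SmallCircuits ℂ n b, eval (coeffVector (degLEMonomials n) f) E = 0)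
      (hn₀ n (le_trans (le_max_left _ _) hn))

/-- **Item 8749 on the full coefficient variables** (`c` may depend on `b`; pointwise, no dilation):
`SingleSizeEquations` holds iff for every `b` there is a scale `c` at which, eventually in `n`, a
nonzero equation of `coeff(SmallCircuits ℂ n b)` has an `N^c`-explicit coefficient function.
[cite: Burgisser2000, Prop. 2.20] -/
theorem singleSizeEquations_iff_explicitCoefficients_full :
    Summit.ValiantsHypothesis.ValiantsHypothesis.Theses.BarrierLever.SingleSizeEquations ↔
    ∀ b : ℕ, ∃ c n₀ : ℕ, ∀ n ≥ n₀,
      ∃ D r : ℕ, D ≤ (Nat.choose (2 * n) n) ^ c ∧ r ≤ (Nat.choose (2 * n) n) ^ c ∧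
      ∃ Q₀ : MvPolynomial ((↥(degLEMonomials n) × Fin (D + 1)) ⊕ Fin r) ℂ,
        complexity Q₀ ≤ (Nat.choose (2 * n) n) ^ c ∧
        Q₀.totalDegree ≤ (Nat.choose (2 * n) n) ^ c ∧
        ∃ E : MvPolynomial ↥(degLEMonomials n) ℂ, E ≠ 0 ∧
          (∀ f ∈ SmallCircuits ℂ n b, eval (coeffVector (degLEMonomials n) f) E = 0) ∧
          (∀ m ∈ E.support, ∀ e, m e ≤ D) ∧
          ∀ m : ↥(degLEMonomials n) →₀ ℕ, (∀ e, m e ≤ D) → coeff m E =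
            ∑ w : Fin r → Bool, eval (fun x => if Sum.elim
              (fun p : ↥(degLEMonomials n) × Fin (D + 1) => decide (m p.1 = (p.2 : ℕ))) w x
              then (1 : ℂ) else 0) Q₀ := by
  classical
  constructor
  · intro h b
    obtain ⟨a, n₀, hn₀⟩ := h b
    refine ⟨2 * a + 7, max n₀ 2, fun n hn => ?_⟩
    haveI : Fintype ↥(degLEMonomials n) := (Finsupp.finite_of_degree_le (σ := Fin n) n).fintype
    obtain ⟨hN, hI⟩ := ExplicitCoefficients.budget (le_trans (le_max_right _ _) hn)
    exact explicit_of_boolSum hN hI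
      (fun E => ∀ f ∈ SmallCircuits ℂ n b, eval (coeffVector (degLEMonomials n) f) E = 0)
      (hn₀ n (le_trans (le_max_left _ _) hn))
  · intro h b
    obtain ⟨c, n₀, hn₀⟩ := h b
    refine ⟨2 * c + 7, max n₀ 2, fun n hn => ?_⟩
    haveI : Fintype ↥(degLEMonomials n) := (Finsupp.finite_of_degree_le (σ := Fin n) n).fintype
    obtain ⟨hN, hI⟩ := ExplicitCoefficients.budget (le_trans (le_max_right _ _) hn)
    exact boolSum_of_explicit hN hI
      (fun E => ∀ f ∈ SmallCircuits ℂ n b, eval (coeffVector (degLEMonomials n) f) E = 0)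
      (hn₀ n (le_trans (le_max_left _ _) hn))

/-- **Crux 8746 (`DefinableDcEquations`) in the same normal form**: there is a super-quasi-quadratic
threshold `m` and ONE scale `c` such that, eventually in `n`, a NONZERO `E ∈ ℂ[degLEMonomials n]`
with `N^c`-explicit coefficient function vanishes at `coeff(f)` for every `f` with `deg f ≤ n` and
`dc(f) ≤ m(n)`. [cite: Burgisser2000, Prop. 2.20] -/
theorem definableDcEquations_iff_explicitCoefficients :
    Summit.ValiantsHypothesis.ValiantsHypothesis.Theses.BarrierLever.DefinableDcEquations ↔
    ∃ m : ℕ → ℕ, (∀ C : ℕ, ∃ n₀ : ℕ, ∀ n ≥ n₀, 2 ^ (C * (Nat.log 2 n + 1) ^ 2) ≤ m n) ∧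
      ∃ c n₀ : ℕ, ∀ n ≥ n₀,
      ∃ D r : ℕ, D ≤ (Nat.choose (2 * n) n) ^ c ∧ r ≤ (Nat.choose (2 * n) n) ^ c ∧
      ∃ Q₀ : MvPolynomial ((↥(degLEMonomials n) × Fin (D + 1)) ⊕ Fin r) ℂ,
        complexity Q₀ ≤ (Nat.choose (2 * n) n) ^ c ∧
        Q₀.totalDegree ≤ (Nat.choose (2 * n) n) ^ c ∧
        ∃ E : MvPolynomial ↥(degLEMonomials n) ℂ, E ≠ 0 ∧
          (∀ f : MvPolynomial (Fin n) ℂ, f.totalDegree ≤ n →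
            determinantalComplexity f ≤ m n →
              eval (coeffVector (degLEMonomials n) f) E = 0) ∧
          (∀ μ ∈ E.support, ∀ e, μ e ≤ D) ∧
          ∀ μ : ↥(degLEMonomials n) →₀ ℕ, (∀ e, μ e ≤ D) → coeff μ E =
            ∑ w : Fin r → Bool, eval (fun x => if Sum.elim
              (fun p : ↥(degLEMonomials n) × Fin (D + 1) => decide (μ p.1 = (p.2 : ℕ))) w x
              then (1 : ℂ) else 0) Q₀ := by
  classical
  constructor
  · rintro ⟨m, hgrow, a, n₀, h⟩
    refine ⟨m, hgrow, 2 * a + 7, max n₀ 2, fun n hn => ?_⟩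
    haveI : Fintype ↥(degLEMonomials n) := (Finsupp.finite_of_degree_le (σ := Fin n) n).fintype
    obtain ⟨hN, hI⟩ := ExplicitCoefficients.budget (le_trans (le_max_right _ _) hn)
    exact explicit_of_boolSum hN hI
      (fun E => ∀ f : MvPolynomial (Fin n) ℂ, f.totalDegree ≤ n →
        determinantalComplexity f ≤ m n → eval (coeffVector (degLEMonomials n) f) E = 0)
      (h n (le_trans (le_max_left _ _) hn))
  · rintro ⟨m, hgrow, c, n₀, h⟩
    refine ⟨m, hgrow, 2 * c + 7, max n₀ 2, fun n hn => ?_⟩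
    haveI : Fintype ↥(degLEMonomials n) := (Finsupp.finite_of_degree_le (σ := Fin n) n).fintype
    obtain ⟨hN, hI⟩ := ExplicitCoefficients.budget (le_trans (le_max_right _ _) hn)
    exact boolSum_of_explicit hN hI
      (fun E => ∀ f : MvPolynomial (Fin n) ℂ, f.totalDegree ≤ n →
        determinantalComplexity f ≤ m n → eval (coeffVector (degLEMonomials n) f) E = 0)
      (h n (le_trans (le_max_left _ _) hn))

end Summit.ValiantsHypothesis.ValiantsHypothesis.Theorems.BarrierLeverDefinableEquations

end
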